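import Literature.AlgebraicGeometry.HodgeTheory.BettiHodgePolynomial
import Literature.AlgebraicGeometry.HodgeTheory.BettiChiYGenusPolynomial
import Literature.AlgebraicGeometry.HodgeTheory.BettiPoincarePolynomial
import HarnessLib

/-!
# The full Hodge diamond of the SELF POWERS of an abelian variety and of an elliptic curve, read off the generating functions: `Π(A^{m+1}) = (1 + y)^{g(m+1)} (1 + z)^{g(m+1)}`,
# `h^{p,q}(A^{m+1}) = C(g(m+1), p)·C(g(m+1), q)`, `P(t; A^{m+1}) = (1 + t)^{2g(m+1)}`, `b_k(A^{m+1}) = C(2g(m+1), k)`, `χ_y(A^{m+1}) = 0`; for an elliptic curve `E`: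
# `Π(E^{m+1}) = (1 + y)^{m+1}(1 + z)^{m+1}`, `h^{p,q}(E^{m+1}) = C(m+1, p)·C(m+1, q)`, `b_k(E^{m+1}) = C(2(m+1), k)` (Lange 2023 Cor. 1.1.18, Thm. 1.1.21 (b); Hirzebruch (22)–(23))

Family `hodge`, lane `lit-hodgefound` (Track 2 foundations library; Layer A1), layer `Literature/AlgebraicGeometry/HodgeTheory`.  THEOREMS ONLY (no definition,
no named fact, no instance; D-0026 net debt `0`).  Sequel of the seat's g25-#5 (`q`, `p_g`, `h^{2,0}`, `h^{1,1}` of `X^{m+1} = powObj X m` by induction), g25-#8/#9/#10 (the displayed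
`χ_y ∈ ℤ[y]`, `P ∈ ℤ[t]`, `Π ∈ ℤ[y][z]`, multiplicative in products and powers, `Π(A) = (1+y)^g (1+z)^g`, `P(A) = (1+t)^{2g}`).  The tree's `AbelianVariety` structure is not closed under
`powObj` syntactically, so the Hodge numbers of `A^{m+1}` are not instances of g24-#9's `h^{p,q}(A) = C(g,p) C(g,q)`; here they are READ OFF THE GENERATING FUNCTIONS: `Π(A^{m+1}) = Π(A)^{m+1}`
(g25-#10) `= ((1+y)^g(1+z)^g)^{m+1}`, and `[y^p z^q]` of the right-hand side is `C(g(m+1),p) C(g(m+1),q)` — every entry of the Hodge diamond of every self power of an abelian variety (in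
particular of `E^n`, the abelian-variety corner of g25-#5 in full), and likewise `b_k(A^{m+1}) = C(2g(m+1), k)` from `P`.

THE PRINTS.  H. Lange (2023) [Lange2023AbelianVarietiesComplex] §1.1.3 Cor. 1.1.18 (PDF p. 27: `Hᵏ(X, ℤ) ≅ ⋀ᵏ H¹(X, ℤ)`, `b_k = C(2g, k)` for a complex torus of dimension `g`), §1.1.5 Thm. 1.1.21 (b)
(PDF p. 25: `H^{p,q}(X) ≅ ⋀^p Ω ⊗ ⋀^q Ω̄`, `h^{p,q} = C(g,p) C(g,q)`) — applied to the abelian variety `A^{m+1}` of dimension `g(m+1)`; F. Hirzebruch (1966) [Hirzebruch1966] §15.11 (22)–(23)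
(held text p0138: `Π_{y,z}` and `χ_y` are multiplicative); A. Hatcher (2002) [HatcherAT2002] §3.2 Exercise 15 (held text p0296: `p(X × Y) = p(X) p(Y)`).

THE OBJECTS (all the tree's and Mathlib's).  `A : AbelianVariety ℂ`, `hA : IsSmoothProjective A.dim A.X`; `powObj A.X m = A^{m+1}` with any witness `h : IsSmoothProjective d (powObj A.X m)`
(`d = A.dim (m+1)` by `IsSmoothProjective.dim_unique`); the displayed `Π`, `χ_y`, `P` of g25-#8/#9/#10; an elliptic curve is `hC : IsSmoothProjective 1 X` with `h^{1,0}(H¹) = 1`.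

WHAT IS PROVED.
* §1 ABELIAN VARIETIES: **`AbelianVariety.hodgePoly_powObj`** (`Π(A^{m+1}) = C((1+y)^{g(m+1)}) · (1+z)^{g(m+1)}`), **`AbelianVariety.hodgeNumber_hodge_powObj`**
  (`h^{p,q}(H^{p+q}(A^{m+1})) = C(g(m+1),p) C(g(m+1),q)`, any witness), `AbelianVariety.poincarePoly_powObj` (`P(A^{m+1}) = (1+t)^{2g(m+1)}`), **`AbelianVariety.finrank_bettiCohomology_powObj`**
  (`b_k(A^{m+1}) = C(2g(m+1), k)`), `AbelianVariety.chiYPoly_powObj_eq_zero` (`χ_y(A^{m+1}) = 0`, `g ≥ 1`).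
* §2 ELLIPTIC CURVES: `BettiUniverse.hodgePoly_curve_of_genus_one` (`Π(E) = C(1+y)·(1+z)`), **`BettiUniverse.hodgePoly_powObj_of_genus_one`**, **`BettiUniverse.hodgeNumber_hodge_powObj_of_genus_one`**
  (`h^{p,q}(E^{m+1}) = C(m+1,p) C(m+1,q)`), `BettiUniverse.poincarePoly_powObj_of_genus_one` (`P(E^{m+1}) = (1+t)^{2(m+1)}`), **`BettiUniverse.finrank_bettiCohomology_powObj_of_genus_one`**
  (`b_k(E^{m+1}) = C(2(m+1), k)`).

DEVIATIONS / SCOPE.  Nothing is defined; the elliptic curve is a genus-one curve in the lane's sense (`h^{1,0} = 1`), no group law is used.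

## References
* [Lange2023AbelianVarietiesComplex] H. Lange, *Abelian Varieties over the Complex Numbers* (2023) — §1.1.3 Cor. 1.1.18 (PDF p. 27); §1.1.5 Thm. 1.1.21 (b) (PDF p. 25).
* [Hirzebruch1966] F. Hirzebruch, *Topological Methods in Algebraic Geometry* (1966) — §15.11 (22)–(23) (held text p0138).
* [HatcherAT2002] A. Hatcher, *Algebraic Topology* (2002) — §3.2 Exercise 15 (held text p0296).
* [Arapura2012] D. Arapura, *Algebraic Geometry over the Complex Numbers* (2012) — §11.1 Example 11.1.2 (PDF p. 174).

## Provenance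
Lane `lit-hodgefound` (Hodge path, Track 2), prover seat `lit-hodgefound-p29` (generation 25), self-proposed row g25-#14 (Hodge diamonds of powers of abelian varieties / elliptic curves; sequel of g25-#5/#8/#9/#10).
-/

noncomputable section

open scoped TensorProduct
open CategoryTheory MonoidalCategory Module Finset
open Polynomial (C)
open Literature.AlgebraicTopology.SingularHomology

namespace Literature.AlgebraicGeometry.HodgeTheory

open Literature.AlgebraicGeometry.Motives
open Literature.AlgebraicGeometry.Motives.HodgeStructure

variable {X : SchemeOver ℂ}

section AV

variable [HodgeTensorFacts.{0, 0}] (A : AbelianVariety ℂ)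

/-! ### §1 Powers of an abelian variety -/

/-- **`Π(A^{m+1}) = C((1+y)^{g(m+1)}) · (1+z)^{g(m+1)}`** (`Π(A^{m+1}) = Π(A)^{m+1}`, g25-#10, and `Π(A) = (1+y)^g (1+z)^g`). [cite: Hirzebruch1966, §15.11 (22) (held text p0138)]
[cite: Lange2023AbelianVarietiesComplex, §1.1.5 Thm. 1.1.21 (b) (PDF p. 25)] -/
theorem AbelianVariety.hodgePoly_powObj (hHD : exists_isReal_hodgeModel) (hA : IsSmoothProjective A.dim A.X) (m : ℕ) {d : ℕ} (h : IsSmoothProjective d (powObj A.X m)) :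
    (∑ i ∈ range (A.dim * (m + 1) + 1), ∑ j ∈ range (A.dim * (m + 1) + 1),
        C (C (((BettiUniverse.hodge hHD h (i + j)).hodgeNumber i j : ℕ) : ℤ) * Polynomial.X ^ i) * Polynomial.X ^ j : Polynomial (Polynomial ℤ)) =
      C ((1 + Polynomial.X) ^ (A.dim * (m + 1))) * (1 + Polynomial.X) ^ (A.dim * (m + 1)) := by
  rw [BettiUniverse.hodgePoly_powObj hHD hA m h, AbelianVariety.hodgePoly A hHD hA, mul_pow, ← Polynomial.C_pow, ← pow_mul, ← pow_mul]

/-- **`h^{p,q}(H^{p+q}(A^{m+1})) = C(g(m+1), p) · C(g(m+1), q)`** for every `p, q` and any smooth-projective witness on `A^{m+1} = powObj A.X m` (Lange's `h^{p,q} = C(g,p)C(g,q)` for the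
abelian variety `A^{m+1}` of dimension `g(m+1)`, read off `Π(A^{m+1})`). [cite: Lange2023AbelianVarietiesComplex, §1.1.5 Thm. 1.1.21 (b) (PDF p. 25)] -/
theorem AbelianVariety.hodgeNumber_hodge_powObj (hHD : exists_isReal_hodgeModel) (hA : IsSmoothProjective A.dim A.X) (m : ℕ) {d : ℕ} (h : IsSmoothProjective d (powObj A.X m))
    (p q : ℕ) : (BettiUniverse.hodge hHD h (p + q)).hodgeNumber p q = (A.dim * (m + 1)).choose p * (A.dim * (m + 1)).choose q := by
  obtain rfl : d = A.dim * (m + 1) := IsSmoothProjective.dim_unique h (isSmoothProjective_powObj hA m)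
  have hc := BettiUniverse.coeff_coeff_hodgePoly hHD h p q
  rw [AbelianVariety.hodgePoly_powObj A hHD hA m h, Polynomial.coeff_C_mul, Polynomial.coeff_one_add_X_pow, ← Polynomial.C_eq_natCast, Polynomial.coeff_mul_C,
    Polynomial.coeff_one_add_X_pow, ← Nat.cast_mul] at hc
  exact_mod_cast hc.symm

omit [HodgeTensorFacts.{0, 0}] in
/-- **`P(t; A^{m+1}) = (1 + t)^{2g(m+1)}`** (witness-free). [cite: Lange2023AbelianVarietiesComplex, §1.1.3 Cor. 1.1.18 (PDF p. 27)] [cite: HatcherAT2002, §3.2 Exercise 15 (held text p0296)] -/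
theorem AbelianVariety.poincarePoly_powObj (hA : IsSmoothProjective A.dim A.X) (m : ℕ) :
    ∑ i ∈ range (2 * (A.dim * (m + 1)) + 1), C (Module.finrank ℚ (bettiCohomology (powObj A.X m) i) : ℤ) * Polynomial.X ^ i = (1 + Polynomial.X) ^ (2 * (A.dim * (m + 1))) := by
  rw [BettiUniverse.poincarePoly_powObj hA m, AbelianVariety.poincarePoly A, ← pow_mul, mul_assoc]

omit [HodgeTensorFacts.{0, 0}] in
/-- **`b_k(A^{m+1}) = C(2g(m+1), k)`** for every `k` (Lange's `b_k = C(2g,k)` for `A^{m+1}`, read off `P(A^{m+1})`). [cite: Lange2023AbelianVarietiesComplex, §1.1.3 Cor. 1.1.18 (PDF p. 27)] -/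
theorem AbelianVariety.finrank_bettiCohomology_powObj (hA : IsSmoothProjective A.dim A.X) (m k : ℕ) :
    Module.finrank ℚ (bettiCohomology (powObj A.X m) k) = (2 * (A.dim * (m + 1))).choose k := by
  have hc := BettiUniverse.coeff_poincarePoly (isSmoothProjective_powObj hA m) k
  rw [AbelianVariety.poincarePoly_powObj A hA m, Polynomial.coeff_one_add_X_pow] at hc
  exact_mod_cast hc.symm

/-- **`χ_y(A^{m+1}) = 0`** for `dim A ≥ 1` (`χ_y(A^{m+1}) = χ_y(A)^{m+1}`, g25-#8, and `χ_y(A) = 0`). [cite: Hirzebruch1966, §15.11 (23) (held text p0138)]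
[cite: Lange2023AbelianVarietiesComplex, §1.1.5 Thm. 1.1.21 (b) (PDF p. 25)] -/
theorem AbelianVariety.chiYPoly_powObj_eq_zero (hHD : exists_isReal_hodgeModel) (hA : IsSmoothProjective A.dim A.X) (hg : 1 ≤ A.dim) (m : ℕ) {d : ℕ}
    (h : IsSmoothProjective d (powObj A.X m)) :
    ∑ i ∈ range (A.dim * (m + 1) + 1), C (∑ q ∈ range (A.dim * (m + 1) + 1), (-1 : ℤ) ^ q * ((BettiUniverse.hodge hHD h (i + q)).hodgeNumber i q : ℤ)) * Polynomial.X ^ i = 0 := by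
  rw [BettiUniverse.chiYPoly_powObj hHD hA m h, AbelianVariety.chiYPoly_eq_zero A hHD hA hg, zero_pow (Nat.succ_ne_zero m)]

end AV

/-! ### §2 Powers of an elliptic curve -/

section Elliptic

variable [HodgeTensorFacts.{0, 0}]

omit [HodgeTensorFacts.{0, 0}] in
/-- **`Π(E) = C(1 + y) · (1 + z)`** for a curve of genus one (`1 + y + z + yz`). [cite: Arapura2012, §11.1 Example 11.1.2 (PDF p. 174)] [cite: Hirzebruch1966, §15.11 (held text p0138)] -/
theorem BettiUniverse.hodgePoly_curve_of_genus_one (hHD : exists_isReal_hodgeModel) (hC : IsSmoothProjective 1 X) (hg : (BettiUniverse.hodge hHD hC 1).hodgeNumber 1 0 = 1) :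
    (∑ i ∈ range (1 + 1), ∑ j ∈ range (1 + 1),
        C (C (((BettiUniverse.hodge hHD hC (i + j)).hodgeNumber i j : ℕ) : ℤ) * Polynomial.X ^ i) * Polynomial.X ^ j : Polynomial (Polynomial ℤ)) =
      C (1 + Polynomial.X) * (1 + Polynomial.X) := by
  rw [BettiUniverse.hodgePoly_curve hHD hC, hg, Nat.cast_one, map_one, one_mul, map_one, one_mul, map_add, map_one]
  ring

/-- **`Π(E^{m+1}) = C((1+y)^{m+1}) · (1+z)^{m+1}`** for an elliptic curve `E` (any witness on the power). [cite: Hirzebruch1966, §15.11 (22) (held text p0138)]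
[cite: Lange2023AbelianVarietiesComplex, §1.1.5 Thm. 1.1.21 (b) (PDF p. 25)] -/
theorem BettiUniverse.hodgePoly_powObj_of_genus_one (hHD : exists_isReal_hodgeModel) (hC : IsSmoothProjective 1 X) (hg : (BettiUniverse.hodge hHD hC 1).hodgeNumber 1 0 = 1) (m : ℕ)
    {d : ℕ} (h : IsSmoothProjective d (powObj X m)) :
    (∑ i ∈ range (1 * (m + 1) + 1), ∑ j ∈ range (1 * (m + 1) + 1),
        C (C (((BettiUniverse.hodge hHD h (i + j)).hodgeNumber i j : ℕ) : ℤ) * Polynomial.X ^ i) * Polynomial.X ^ j : Polynomial (Polynomial ℤ)) =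
      C ((1 + Polynomial.X) ^ (m + 1)) * (1 + Polynomial.X) ^ (m + 1) := by
  rw [BettiUniverse.hodgePoly_powObj hHD hC m h, BettiUniverse.hodgePoly_curve_of_genus_one hHD hC hg, mul_pow, ← Polynomial.C_pow]

/-- **`h^{p,q}(H^{p+q}(E^{m+1})) = C(m+1, p) · C(m+1, q)`** for an elliptic curve `E`, every `p, q`, any witness — the binomial Hodge diamond of `E^n` (recovering g25-#5's `q = n`,
`p_g = 1`, `h^{2,0} = C(n,2)`, `h^{1,1} = n²`). [cite: Lange2023AbelianVarietiesComplex, §1.1.5 Thm. 1.1.21 (b) (PDF p. 25)] -/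
theorem BettiUniverse.hodgeNumber_hodge_powObj_of_genus_one (hHD : exists_isReal_hodgeModel) (hC : IsSmoothProjective 1 X) (hg : (BettiUniverse.hodge hHD hC 1).hodgeNumber 1 0 = 1)
    (m : ℕ) {d : ℕ} (h : IsSmoothProjective d (powObj X m)) (p q : ℕ) : (BettiUniverse.hodge hHD h (p + q)).hodgeNumber p q = (m + 1).choose p * (m + 1).choose q := by
  obtain rfl : d = 1 * (m + 1) := IsSmoothProjective.dim_unique h (isSmoothProjective_powObj hC m)
  have hc := BettiUniverse.coeff_coeff_hodgePoly hHD h p q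
  rw [BettiUniverse.hodgePoly_powObj_of_genus_one hHD hC hg m h, Polynomial.coeff_C_mul, Polynomial.coeff_one_add_X_pow, ← Polynomial.C_eq_natCast, Polynomial.coeff_mul_C,
    Polynomial.coeff_one_add_X_pow, ← Nat.cast_mul] at hc
  exact_mod_cast hc.symm

omit [HodgeTensorFacts.{0, 0}] in
/-- **`P(t; E^{m+1}) = (1 + t)^{2(m+1)}`** for an elliptic curve `E`. [cite: Lange2023AbelianVarietiesComplex, §1.1.3 Cor. 1.1.18 (PDF p. 27)] [cite: HatcherAT2002, §3.2 Exercise 15 (held text p0296)] -/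
theorem BettiUniverse.poincarePoly_powObj_of_genus_one (hHD : exists_isReal_hodgeModel) (hC : IsSmoothProjective 1 X) (hg : (BettiUniverse.hodge hHD hC 1).hodgeNumber 1 0 = 1) (m : ℕ) :
    ∑ i ∈ range (2 * (1 * (m + 1)) + 1), C (Module.finrank ℚ (bettiCohomology (powObj X m) i) : ℤ) * Polynomial.X ^ i = (1 + Polynomial.X) ^ (2 * (m + 1)) := by
  rw [BettiUniverse.poincarePoly_powObj_curve_genus hHD hC m, hg, Nat.cast_one, mul_one, pow_mul]
  congr 1
  rw [show (2 : ℤ) = 1 + 1 by norm_num, map_add, map_one]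
  ring

omit [HodgeTensorFacts.{0, 0}] in
/-- **`b_k(E^{m+1}) = C(2(m+1), k)`** for an elliptic curve `E` and every `k`. [cite: Lange2023AbelianVarietiesComplex, §1.1.3 Cor. 1.1.18 (PDF p. 27)] -/
theorem BettiUniverse.finrank_bettiCohomology_powObj_of_genus_one (hHD : exists_isReal_hodgeModel) (hC : IsSmoothProjective 1 X) (hg : (BettiUniverse.hodge hHD hC 1).hodgeNumber 1 0 = 1)
    (m k : ℕ) : Module.finrank ℚ (bettiCohomology (powObj X m) k) = (2 * (m + 1)).choose k := by
  have hc := BettiUniverse.coeff_poincarePoly (isSmoothProjective_powObj hC m) k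
  rw [BettiUniverse.poincarePoly_powObj_of_genus_one hHD hC hg m, Polynomial.coeff_one_add_X_pow] at hc
  exact_mod_cast hc.symm

end Elliptic

end Literature.AlgebraicGeometry.HodgeTheory

end
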